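import Summits.BirchSwinnertonDyer.Rank1Residual.O5.HeegnerLogTransportThreeStepZeroEnd
import HarnessLib
import HarnessLib.Audit.Tags

/-!
# O5 (t′) — KL3 part 18, file 2 (§4): the END of record with the binders `h3K` and — for odd `d_K` — `htamGd` DISCHARGED (o5-r2 GEN 23)

Research route (cell `b2b-bsdres`, class O5 = tame potentially-supersingular additive `p = 3` (t′), `9 ‖ N`);
**honest framing**: a CONDITIONAL theorem whose displayed inputs are published theorems vendored as named
facts + per-pair binders; nothing booked, no mark / label / count / tier of `RESIDUAL-MAP.md` moves,
census = EVIDENCE (never a Literature fact); O5 stays OPEN as a class. THEOREMS ONLY — 0 `def`,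
0 `@[conjecture]`, 0 Literature facts, no `sorry`.

## Contents (the source's §4 bullet, verbatim; §§0–3 are the sibling file 1 `O5/HeegnerLogTransportThreeStepZeroEnd.lean`)

* §4 (o5-r2 GEN 23) `o5_index_unit_of_ordinary_companion_cited_s0e` — §3 with the two residual
  non-certificate binders discharged by END-author glue over tree theorems: `h3K` DELETED
  (`satisfiesHeegnerHypothesis_three_of_addv`: `hH` + Carayol `N = N_W` from `hmod` + `3 ∣ N_W` from
  `hadd`) and `htamGd` WEAKENED to `htamGd' : Even d_K → 3 ∤ ∏c(G_d)` (for odd `d_K` proved from `htamG`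
  by the cell's X2 transport, `not_three_dvd_tamagawaProduct_twist_of_heegner`). THIS is the END of
  record of o5-r2 GEN 23.

Displayed per-row inputs of the END of record after this file (W = the (t′) curve of conductor `N`, G = a
`3`-congruent good-ordinary companion of conductor `N′`, `K` Heegner for `N` and `N′` with `d_K < -4` and
`3` split): the congruence `hcong` (Sturm-bound certificate), `hρ` (surjective mod `3`), `hadd`, `ht3`/`htℓ`
(no local `3`-torsion at `3` and at `ℓ ∣ N N′`; dischargeable by `3 ∤ c_ℓ · #W̃_ns(𝔽_ℓ)`, harvest-2's
`GoodReductionLocalThreeTorsion`), `hunitW`/`hunitG` (Kriz–Li Euler factors off `3`), `htam`/`htamG`/`htamGd`,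
`hordG`, the Heegner points `P`, `P′` of the data `D`, `D′` non-torsion, `hshaW : #Ш(W/K)[3^∞] = 1` (§2;
in §3: the two `3`-descent counts + the twist's torsion), `hQW`
(a non-torsion `Q ∈ W(K)` with unit-normalised `3`-adic logarithm at `𝔭`: census column `dE = 0`, part 12),
`hcD` (`ord₃ c(D) = 0`) and `hc3'` (`3 ∤ c(D′)`). On the companion side NOTHING analytic is displayed.

[cite: KrizLi2019, Thm. 1.16, Rem. 1.17] [cite: YanZhu2024MainConjNonCM, Thm. 4.15 (§4.6) = Cor. 1.4]
[cite: GrossZagier1986, Thm. I.6.3 with V.§2 (pp. 310–312)] [cite: Miller2011LMS, Def. 1.1]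
[cite: Oesterle1988Gauss, II §1 p. 53] [cite: SilvermanAEC2009, VII.1 Prop. 1.3(b), X.4 Thm. 4.2(a) and X.5 Cor. 5.4]
[cite: JetchevSkinnerWan2017, §7.4.1 (arXiv:1512.06894 p. 30)]
[cite: DiamondShurman2005, Thm. 8.8.1 and §8.3 (PDF p. 353)] [cite: AtkinLehner1970, Thm. 4]

## TYPER PLACEMENT NOTE (cc-typer-5 GEN 19 = O5 §3.5 / O6 §3.4 typer of record; by-name ask A-O5-G23-1 of o5-r2 GEN 23, HOME/INBOX.md l.14299 (1)
+ l.14331 / l.14351 / close l.14380: 'part 18 := v2 b117be44ce0dd2b4, AFTER parts 15 + 19; v1 2a106af2d8c83d2e SUPERSEDED (never placed)'; order of record 15 -> 18)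

Source: `HOME/b2b-bsdres-o5-r2/gen23/lean/HeegnerLogTransportThreeStepZeroEnd.lean` sha16 `b117be44ce0dd2b4` (433 l.; `gen23/SHA16.txt`; o5-r2's checks: merged scratch on TREE imports
`gen23/lean/scratch/scratch_p15_17_19_18v2.lean` 3dbe6fb4831d1df0 rc 0 / 0 err / 0 warn / 0 sorry (snapshot + `--no-snap`), `#print axioms
o5_index_unit_of_ordinary_companion_cited_s0e` = {propext, Classical.choice, Quot.sound}), re-hashed by the typer right before writing.  SPLIT (typer; the source's
433 lines exceed the gate's 400-line `lint.size` for new files — the one-file placement 1f907df27da0333a dry-ran BOUNCED `lint.size` 454): KL3 part 18 = TWO files,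
every declaration block byte-identical and in source order (script `class-closure/typer-5/gen19/g23_split.py`, anchors asserted):
  THIS file (file 2) = the imports of file 1 replaced by `import …O5.HeegnerLogTransportThreeStepZeroEnd` (file 1) + this header, whose framing paragraph, §4 bullet,
  'Displayed per-row inputs' paragraph and cite lines are source l.14–18 / l.56–61 / l.63–76 VERBATIM (+ the two cites of §4's docstrings) + source l.79–94
  (`noncomputable section`, `open`s, `namespace`) + source §4 l.304–433 VERBATIM (`three_dvd_conductorNorm_of_addv`, `satisfiesHeegnerHypothesis_three_of_addv`,
  `not_three_dvd_tamagawaProduct_twist_of_heegner`, END of record `o5_index_unit_of_ordinary_companion_cited_s0e`); file 1 = source l.1–302 (§0–§3) + closing `end`s.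
Placed AFTER file 1 and parts 15 (p353868) / 17 (p352755) / 19 (p352972); farm check + DEDUP as in file 1.
CONTENT LABELS (source, unchanged): THEOREMS ONLY — 0 `def`, 0 `@[conjecture]`, 0 Literature facts (net named-fact debt 0), no `sorry`; END-author glue over tree theorems
BY NAME (`IsNewformOf.level_eq_conductorNorm_of_exists_isNewformOf`, `WeierstrassCurve.dvd_conductorNorm_iff_not_hasGoodReductionAtPrime`,
`X2.padicValNat_tamagawaProduct_twist_of_heegner_of_odd`, `tamagawaProduct_pos'`, file 1's `not_three_dvd_discr_of_split` / `…_cited_s0d`), nothing re-proved.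
KL3 parts in the tree: 1–3 p340741 / p341262 / p341640 (part 1 doc restamp p353140), Global p342632, OrdCompanion p343587 + p344465, OrdSelmer p345030 + p345686,
OrdTwist p346273, Residual Engine p347366 + Residual p348865 + End p350277, BaseSelmer p349318, ExactCount p349954, GoodSelmer p350559, TameTamagawa p350983,
RatLogUnit p351404, ResidualEndFacts p352109, BaseSelmerCount p352220, KrizLiGlue p352538, StepZero p352755, ShaDescent p352972, CitedEnd p353868; Literature index
lemma p344022, A314 p350088.  HONEST FRAMING (cell `b2b-bsdres`): research route, lane CLASS-CLOSURE §3.5 O5; CONDITIONAL theorems — nothing asserted beyond the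
displayed binders, nothing booked, no mark of `RESIDUAL-MAP.md` moves; census = EVIDENCE, never a Literature fact; O5 OPEN.
-/

noncomputable section

open scoped Classical

open WeierstrassCurve Literature.NumberTheory.EllipticCurves
  Literature.NumberTheory.EllipticCurves.ModularForms
  Literature.NumberTheory.EllipticCurves.Rank1Residual
  Literature.NumberTheory.EllipticCurves.Rank1Residual.Typed
open Summit.BirchSwinnertonDyer.Rank1Residual.X11b (embAt)
open IsDedekindDomain (HeightOneSpectrum)
open Literature.NumberTheory.GaloisCohomology (poitouTate_selmerStructure_duality)
open Literature.NumberTheory.GaloisRepresentations (localEulerPoincareCharacteristic)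
open scoped NumberField

namespace Summit.BirchSwinnertonDyer.Rank1Residual.O5.HeegnerLogTransport

/-! ## §4 The END of record with the binders `h3K` and — for odd `d_K` — `htamGd` DISCHARGED (o5-r2 GEN 23)

Both residual per-row binders of §§1–3 that are not certificates collapse to tree theorems (END-author
glue; no new input): `h3K` (`3` splits in `K`) follows from the Heegner hypothesis `hH` for the level of
`W`'s parametrisation, Carayol's `N = N_W` (from modularity, `IsNewformOf.level_eq_conductorNorm_of_exists_isNewformOf`)
and `3 ∣ N_W` (`Addv W 3`: additive is bad, `dvd_conductorNorm_iff_not_hasGoodReductionAtPrime`,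
Diamond–Shurman §8.3); and for ODD `d_K` the Tamagawa symmetry `ord₃ ∏c(G_d) = ord₃ ∏c(G)` is the
cell's X2 transport `X2.padicValNat_tamagawaProduct_twist_of_heegner_of_odd` (Jetchev–Skinner–Wan
§7.4.1 (eq:tamK) at `p = 3`: every `q ∣ N′` splits in `K`, and at `ℓ ∣ d_K`, `ℓ` odd, `c_ℓ(G_d) ∈ {1,2,4}`),
so `htamGd` follows from `htamG`. For EVEN `d_K` (`2 ∣ d_K`, `G` good at `2`, `G_d` additive at `2`)
the value `c₂(G_d)` is not transported in the tree (it is `≤ 4`; `= 3` would need Kodaira type IV/IV* at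
`2`), so the datum `3 ∤ ∏c(G_d)` stays DISPLAYED in that case only — binder
`htamGd' : Even d_K → 3 ∤ ∏c(G_d)` (the census chooses `d_K` odd whenever it can, and then owes nothing). -/

/-- `3 ∣ N_W` for a curve with additive (hence bad) reduction at `3` (`p ∣ N_E ↔ ¬ good at p`,
Diamond–Shurman §8.3 / Silverman ATAEC IV.10.2(a), tree `dvd_conductorNorm_iff_not_hasGoodReductionAtPrime`).
[cite: DiamondShurman2005, §8.3 (PDF p. 353)] -/
theorem three_dvd_conductorNorm_of_addv (W : WeierstrassCurve ℚ) [W.IsElliptic] (hadd : Addv W 3) :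
    3 ∣ W.conductorNorm ℤ :=
  (W.dvd_conductorNorm_iff_not_hasGoodReductionAtPrime 3).mpr hadd.1

/-- **The binder `h3K` of §§1–3 is redundant**: `Heegner(N, K)` for the level `N` of a modular
parametrisation of `W` (`N = N_W`, Carayol from modularity) and `3 ∣ N_W` (`W` additive at `3`) give
`SatisfiesHeegnerHypothesis 3 K`, i.e. `3` splits in `K` (`SatisfiesHeegnerHypothesis.of_dvd`).
[cite: DiamondShurman2005, Thm. 8.8.1 and §8.3 (PDF p. 353)] [cite: AtkinLehner1970, Thm. 4] -/
theorem satisfiesHeegnerHypothesis_three_of_addv (hmod : exists_isNewformOf)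
    (W : WeierstrassCurve ℚ) [W.IsElliptic] (hadd : Addv W 3)
    {N : ℕ} [NeZero N] (D : ModularParametrizationData W N)
    (K : Type) [Field K] (hH : SatisfiesHeegnerHypothesis N K) : SatisfiesHeegnerHypothesis 3 K := by
  have hN : N = W.conductorNorm ℤ :=
    IsNewformOf.level_eq_conductorNorm_of_exists_isNewformOf hmod D.isNewformOf
  refine hH.of_dvd ?_
  rw [hN]
  exact three_dvd_conductorNorm_of_addv W hadd

/-- **The binder `htamGd` of §§1–3 is redundant for odd `d_K`**: for the good-ordinary companion `G`
(globally minimal), `K` imaginary quadratic Heegner for the level `N′` of `G`'s parametrisation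
(`N′ = N_G`, Carayol from modularity) with `3` split in `K`, and ANY model `G_d = C • G^{(d_K)}` of the
twist: if `d_K` is odd then `ord₃ ∏_ℓ c_ℓ(G_d) = ord₃ ∏_ℓ c_ℓ(G)`
(`X2.padicValNat_tamagawaProduct_twist_of_heegner_of_odd`, Jetchev–Skinner–Wan §7.4.1 at `p = 3`), so
`3 ∤ ∏c(G)` gives `3 ∤ ∏c(G_d)` (Tamagawa products are positive, `tamagawaProduct_pos'`); if `d_K` is
even the conclusion is the displayed datum `htamGd'`. [cite: JetchevSkinnerWan2017, §7.4.1 (eq:tamK) (pp. 29–31)]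
[cite: SilvermanATAEC1994, Cor. IV.9.2(d) and Table 4.1] [cite: SilvermanAEC2009, Cor. VII.6.2 (PDF p. 177)] -/
theorem not_three_dvd_tamagawaProduct_twist_of_heegner (hmod : exists_isNewformOf)
    (G Gd : WeierstrassCurve ℚ) [G.IsElliptic] [G.IsGloballyMinimal] [Gd.IsElliptic]
    {N' : ℕ} [NeZero N'] (D' : ModularParametrizationData G N')
    (K : Type) [Field K] [NumberField K] (hK : IsImaginaryQuadratic K)
    (hH' : SatisfiesHeegnerHypothesis N' K) (h3K : SatisfiesHeegnerHypothesis 3 K)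
    (hGd : ∃ C : VariableChange ℚ, C • G.quadraticTwist (NumberField.discr K : ℚ) = Gd)
    (htamG : ¬ 3 ∣ G.tamagawaProduct)
    (htamGd' : Even (NumberField.discr K) → ¬ 3 ∣ Gd.tamagawaProduct) :
    ¬ 3 ∣ Gd.tamagawaProduct := by
  rcases Int.even_or_odd (NumberField.discr K) with hev | hodd
  · exact htamGd' hev
  haveI : Fact (Nat.Prime 3) := ⟨Nat.prime_three⟩
  have h3d : ¬ ((3 : ℤ) ∣ NumberField.discr K) := not_three_dvd_discr_of_split K hK h3K
  have hN' : N' = G.conductorNorm ℤ :=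
    IsNewformOf.level_eq_conductorNorm_of_exists_isNewformOf hmod D'.isNewformOf
  have hHG : SatisfiesHeegnerHypothesis (G.conductorNorm ℤ) K := hN' ▸ hH'
  obtain ⟨Cd, hCd⟩ := hGd
  have hv : padicValNat 3 Gd.tamagawaProduct = padicValNat 3 G.tamagawaProduct :=
    X2.padicValNat_tamagawaProduct_twist_of_heegner_of_odd G 3 (by decide) K hK hodd h3d hHG Cd hCd
  intro h3
  exact (dvd_iff_padicValNat_ne_zero Gd.tamagawaProduct_pos'.ne').mp h3
    (hv.trans (padicValNat.eq_zero_of_not_dvd htamG))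

/-- **O5 (t′) END of record, certificate form with the non-certificate residuals discharged
(o5-r2 GEN 23).** §3 (`o5_index_unit_of_ordinary_companion_cited_s0d`) with the binder `h3K` DELETED
(proved from `hH`, `hadd`, `hmod`: `satisfiesHeegnerHypothesis_three_of_addv`) and `htamGd` WEAKENED to
`htamGd' : Even d_K → 3 ∤ ∏c(G_d)` (for odd `d_K` it is proved from `htamG`:
`not_three_dvd_tamagawaProduct_twist_of_heegner`). Displayed per-row inputs now: the congruence `hcong`,
`hρ`, `hadd`, `ht3`/`htℓ`, `hunitW`/`hunitG`, `htam`/`htamG` (+ `htamGd'` only when `d_K` is even), `hordG`,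
the Heegner points `P`, `P′` non-torsion, the two `3`-descent counts + the twist's torsion, `hQW`
(`dE = 0`), `hcD`, `hc3'`, `d_K < -4`; every one a decidable certificate or a published theorem BY NAME.
Conclusion `3 ∤ [W(K) : ℤP]`. [cite: KrizLi2019, Thm. 1.16, Rem. 1.17] [cite: SilvermanAEC2009, Thm. X.4.2(a)]
[cite: JetchevSkinnerWan2017, §7.4.1 (arXiv:1512.06894 pp. 29–31)] [cite: YanZhu2024MainConjNonCM, Thm. 4.15 (§4.6) = Cor. 1.4]
[cite: GrossZagier1986, Thm. I.6.3 with V.§2 (pp. 310–312)] [cite: DiamondShurman2005, Thm. 8.8.1, §8.3] -/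
theorem o5_index_unit_of_ordinary_companion_cited_s0e
    (hKL : KrizLi2019.thm116_padicLogHeegner_congruence)
    (hPT : ∀ (K : Type) [Field K] [NumberField K], poitouTate_selmerStructure_duality K)
    (hEP : ∀ (K : Type) [Field K] [NumberField K] (v : HeightOneSpectrum (𝓞 K)),
      localEulerPoincareCharacteristic (v.adicCompletion K))
    (hYZ : YanZhu2026.thm415_padicValRat_bsd_rank_le_one)
    (hW20 : Wuthrich2014.lemma20_surjective_threeAdic_of_semistable)
    (hmod : exists_isNewformOf) (hGZK : rank_eq_analyticRank_of_analyticRank_le_one)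
    (W G : WeierstrassCurve ℚ) [W.IsElliptic] [W.IsGloballyMinimal] [G.IsElliptic] [G.IsGloballyMinimal]
    (hcong : ∀ ℓ : ℕ, ℓ.Prime → ¬ (ℓ ∣ 3 * W.conductorNorm ℤ * G.conductorNorm ℤ) →
      ((W.LFunction ℓ : ℤ) : ZMod 3) = ((G.LFunction ℓ : ℤ) : ZMod 3))
    (hρ : W.HasSurjectiveModNGaloisRep 3) (hadd : Addv W 3) (ht3 : NoLocalThreeTorsionAt W 3)
    (htℓ : ∀ (ℓ : ℕ) [Fact ℓ.Prime], ℓ ≠ 3 → (ℓ : ℤ) ∣ W.conductorNorm ℤ * G.conductorNorm ℤ →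
      NoLocalThreeTorsionAt W ℓ)
    (hunitW : ∀ ℓ ∈ klSet W G, ℓ ≠ 3 → padicValInt 3 (nsCount W ℓ) = 0)
    (hunitG : ∀ ℓ ∈ klSet G W, ℓ ≠ 3 → padicValInt 3 (nsCount G ℓ) = 0)
    (htam : ¬ 3 ∣ W.tamagawaProduct) (htamG : ¬ 3 ∣ G.tamagawaProduct) (hordG : GoodOrd G 3)
    (Gd : WeierstrassCurve ℚ) [Gd.IsElliptic] [Gd.IsGloballyMinimal]
    {N N' : ℕ} [NeZero N] [NeZero N'] (D : ModularParametrizationData W N)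
    (D' : ModularParametrizationData G N')
    (K : Type) [Field K] [NumberField K] (hK : IsImaginaryQuadratic K)
    (hH : SatisfiesHeegnerHypothesis N K) (hH' : SatisfiesHeegnerHypothesis N' K)
    (hKoW : kolyvagin N W K) (hKoG : kolyvagin N' G K) (hGZG : gross_zagier N' G K)
    (hd : NumberField.discr K < -4)
    (hGd : ∃ C : VariableChange ℚ, C • G.quadraticTwist (NumberField.discr K : ℚ) = Gd)
    (htamGd' : Even (NumberField.discr K) → ¬ 3 ∣ Gd.tamagawaProduct)
    (H : HeegnerDatum N (NumberField.discr K)) (H' : HeegnerDatum N' (NumberField.discr K))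
    (ι : K →+* ℂ) (𝔭 : HeightOneSpectrum (𝓞 K)) (h𝔭 : ((3 : ℕ) : 𝓞 K) ∈ 𝔭.asIdeal)
    (he : 𝔭.asIdeal.ramificationIdx (𝓞 ℚ) = 1) (hf : 𝔭.asIdeal.inertiaDeg (𝓞 ℚ) = 1)
    (P : (W.baseChange K).toAffine.Point) (P' : (G.baseChange K).toAffine.Point)
    (hP : WeierstrassCurve.Affine.Point.map ι.toRatAlgHom P = heegnerPointComplex D H)
    (hP' : WeierstrassCurve.Affine.Point.map ι.toRatAlgHom P' = heegnerPointComplex D' H')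
    (hPinf : ¬ IsOfFinAddOrder P) (hP'inf : ¬ IsOfFinAddOrder P')
    (Wt : WeierstrassCurve ℚ) [Wt.IsElliptic]
    (hWt : ∃ C : VariableChange ℚ, C • W.quadraticTwist (NumberField.discr K : ℚ) = Wt)
    (htorst : ¬ 3 ∣ Wt.torsionOrder)
    (hSelW : Nat.card (W.selmerGroup (3 : ℤ)) = 3 ^ W.mordellWeilRank)
    (hSelWt : Nat.card (Wt.selmerGroup (3 : ℤ)) = 3 ^ Wt.mordellWeilRank)
    (hQW : ∃ Q : (W.baseChange K).toAffine.Point, ¬ IsOfFinAddOrder Q ∧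
      X11b.padicLogOrd W 3 (embAt K 3 𝔭 h𝔭 he hf) Q = 0)
    (hcD : padicValInt 3 D.maninConstant = 0) (hc3' : ¬ ((3 : ℤ) ∣ D'.maninConstant)) :
    padicValNat 3 (AddSubgroup.zmultiples P).index = 0 := by
  have h3K : SatisfiesHeegnerHypothesis 3 K :=
    satisfiesHeegnerHypothesis_three_of_addv hmod W hadd D K hH
  have htamGd : ¬ 3 ∣ Gd.tamagawaProduct :=
    not_three_dvd_tamagawaProduct_twist_of_heegner hmod G Gd D' K hK hH' h3K hGd htamG htamGd'
  exact o5_index_unit_of_ordinary_companion_cited_s0d hKL hPT hEP hYZ hW20 hmod hGZK W G hcong hρ hadd ht3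
    htℓ hunitW hunitG htam htamG hordG Gd htamGd D D' K hK hH hH' h3K hKoW hKoG hGZG hd hGd H H' ι 𝔭 h𝔭
    he hf P P' hP hP' hPinf hP'inf Wt hWt htorst hSelW hSelWt hQW hcD hc3'

end Summit.BirchSwinnertonDyer.Rank1Residual.O5.HeegnerLogTransport

end
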